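import Literature.Topology.FourManifolds.Handles
import Literature.Topology.FourManifolds.MorseAffine
import Literature.Topology.FourManifolds.NiceMorseFunctions
import Literature.Topology.FourManifolds.HCobordismEliminationSteps
import Literature.Topology.FourManifolds.SPC4HandlesCancelStep
import Literature.Topology.FourManifolds.DisjointSpheresSlab
import Mathlib.Tactic.IntervalCases
import Mathlib.Tactic.NormNum

/-!
# Stub `stub_mazurRearrangement` of line `property-r-mazur-halves` for crux `ConvexBisection.ContractibleTwistedDoubleStandard`
(item stmt-SmoothPoincare4-3546, route route-SmoothPoincare4-ConvexBisection, skeleton m4 "smooth sectors")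

**Milnor's final rearrangement for an adapted Morse function of profile `(1,1,1)` on a compact
`4`-manifold with boundary.**  A Morse function `f` adapted to `∂W`
(`Literature.Topology.FourManifolds.IsMorseAdapted`: Morse, `≡ 1` and regular on `∂W`, `< 1`
inside; Milnor 1965, Def. 3.1 with `V₀ = ∅`) with critical points of index `≤ 2`, exactly one of
each index `0`, `1`, `2`, can be replaced by an adapted Morse function `g` with the same profile
whose index-`2` critical value lies above a level `c < 1` containing no critical value, and whose
index-`0` and index-`1` critical values lie below `c`.

Proof.  View `W` as the triad `(W; ∅, ∂W)` (`Cobordism.ofBoundary 3 W`); rescale `f` to a Morse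
function `s f + (1 - s)` on this triad with the same critical points of every index
(`IsMorseAdapted.exists_isMorseFunction_ofBoundary`); apply Milnor's Thm. 4.8 for triads, proved in
the tree (`Cobordism.Milnor1965_finalRearrangement_holds`): the result is a *nice* Morse function
`g` on the triad — value `niceLevel 3 k = (k + ½)/5` at each critical point of index `k` — with
the same critical points and indices; read `g` back as an adapted Morse function
(`Cobordism.IsMorseFunction.isMorseAdapted_ofBoundary`) and take `c = 2/5`, which separates
`niceLevel 3 1 = 3/10` from `niceLevel 3 2 = 1/2`.

## References

* J. Milnor, *Lectures on the h-cobordism theorem*, Princeton Mathematical Notes (1965), Def. 3.1,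
  Thm. 4.8 (alternate version) and Def. 4.9. [MilnorHCobordism1965]
-/

noncomputable section

-- the prescribed namespace `Summit.<P>.<Sub>.…` duplicates `SmoothPoincare4` (P = Sub)
set_option linter.dupNamespace false

open scoped Manifold ContDiff Topology
open Set Function Literature.Topology.FourManifolds

namespace Summit.SmoothPoincare4.SmoothPoincare4.Theorems.ContractibleTwistedDoubleStandard.PropertyRMazurHalves

/-- **The nice levels of indices `≤ 2` on a `4`-dimensional triad against the level `2/5`.**
`niceLevel 3 k = (k + ½)/5` is `1/10`, `3/10`, `1/2` for `k = 0, 1, 2`; none equals `2/5`, and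
it is `< 2/5` exactly for `k ≤ 1` (Milnor 1965, Def. 4.9, read in the tree's
`[0, 1]`-normalisation). [cite: MilnorHCobordism1965, Def. 4.9] -/
private theorem niceLevel_three_ne_and_lt_iff {k : ℕ} (hk : k ≤ 2) :
    Cobordism.niceLevel 3 k ≠ 2 / 5 ∧ (Cobordism.niceLevel 3 k < 2 / 5 ↔ k ≤ 1) := by
  interval_cases k <;> norm_num [Cobordism.niceLevel]

/-- **Stub `stub_mazurRearrangement` (Milnor's final rearrangement, profile `(1,1,1)`).**  On a
compact `4`-manifold with boundary `W`, an adapted Morse function `f` (Milnor 1965, Def. 3.1 with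
`V₀ = ∅`) with all indices `≤ 2` and exactly one critical point of each index `0`, `1`, `2` can be
replaced by an adapted Morse function `g` with the same three properties together with a level
`c < 1` which is not a critical value of `g` and such that a critical point of `g` lies below `c`
iff its index is `≤ 1`.  Proof: regard `W` as the triad `(W; ∅, ∂W)` (`Cobordism.ofBoundary`),
rescale `f` into Milnor's normalisation (`IsMorseAdapted.exists_isMorseFunction_ofBoundary`, same
critical points of every index), apply Thm. 4.8 for triads
(`Cobordism.Milnor1965_finalRearrangement_holds`: a nice Morse function with the same critical
points and indices, value `(k + ½)/5` at index `k`), read it back as an adapted Morse function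
(`Cobordism.IsMorseFunction.isMorseAdapted_ofBoundary`) and take `c = 2/5 ∈ (3/10, 1/2)`.
[cite: MilnorHCobordism1965, Thm. 4.8] -/
theorem stub_mazurRearrangement :
    ∀ (W : Type) [TopologicalSpace W] [T2Space W] [SecondCountableTopology W]
      [ChartedSpace (EuclideanHalfSpace 4) W] [IsManifold (𝓡∂ 4) ∞ W] [CompactSpace W] (f : W → ℝ),
      IsMorseAdapted (𝓡∂ 4) f →
      (∀ z, IsMCriticalPt (𝓡∂ 4) f z → morseIndex (𝓡∂ 4) f z ≤ 2) →
      (criticalSetOfIndex (𝓡∂ 4) f 0).ncard = 1 → (criticalSetOfIndex (𝓡∂ 4) f 1).ncard = 1 →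
      (criticalSetOfIndex (𝓡∂ 4) f 2).ncard = 1 →
      ∃ (g : W → ℝ) (c : ℝ), IsMorseAdapted (𝓡∂ 4) g ∧
        (∀ z, IsMCriticalPt (𝓡∂ 4) g z → morseIndex (𝓡∂ 4) g z ≤ 2) ∧
        (criticalSetOfIndex (𝓡∂ 4) g 0).ncard = 1 ∧ (criticalSetOfIndex (𝓡∂ 4) g 1).ncard = 1 ∧
        (criticalSetOfIndex (𝓡∂ 4) g 2).ncard = 1 ∧
        c < 1 ∧ (∀ z, IsMCriticalPt (𝓡∂ 4) g z → g z ≠ c) ∧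
        (∀ z, IsMCriticalPt (𝓡∂ 4) g z → (g z < c ↔ morseIndex (𝓡∂ 4) g z ≤ 1)) := by
  intro W _ _ _ _ _ _ f hf hle h0 h1 h2
  haveI : CompactSpace ((𝓡∂ (3 + 1)).boundary W) := compactSpace_boundary 3 W
  -- Step 1: rescale `f` into Milnor's normalisation on the triad `(W; ∅, ∂W)`
  obtain ⟨s, -, hF, hSf⟩ := hf.exists_isMorseFunction_ofBoundary (n := 3)
  -- Step 2: Milnor's Thm. 4.8 on the triad: a nice Morse function `g`, same critical points
  -- and indices
  obtain ⟨g, hg, hcrit, hind⟩ := Cobordism.Milnor1965_finalRearrangement_holds hF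
  have hSg : ∀ k, criticalSetOfIndex (𝓡∂ (3 + 1)) g k = criticalSetOfIndex (𝓡∂ 4) f k :=
    fun k => (criticalSetOfIndex_congr hcrit hind k).trans (hSf k)
  -- Step 3: the index bound transfers
  have hleg : ∀ z, IsMCriticalPt (𝓡∂ (3 + 1)) g z → morseIndex (𝓡∂ (3 + 1)) g z ≤ 2 := by
    intro z hz
    have hzf : z ∈ criticalSetOfIndex (𝓡∂ 4) f (morseIndex (𝓡∂ (3 + 1)) g z) := by
      rw [← hSg]; exact ⟨hz, rfl⟩
    calc morseIndex (𝓡∂ (3 + 1)) g z = morseIndex (𝓡∂ 4) f z := hzf.2.symm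
      _ ≤ 2 := hle z hzf.1
  -- Step 4: read `g` back on `W`, with `c = 2/5`
  refine ⟨g, 2 / 5, hg.1.isMorseAdapted_ofBoundary, hleg, (congrArg Set.ncard (hSg 0)).trans h0,
    (congrArg Set.ncard (hSg 1)).trans h1, (congrArg Set.ncard (hSg 2)).trans h2, by norm_num,
    fun z hz => ?_, fun z hz => ?_⟩
  · rw [hg.apply_eq hz]
    exact (niceLevel_three_ne_and_lt_iff (hleg z hz)).1
  · rw [hg.apply_eq hz]
    exact (niceLevel_three_ne_and_lt_iff (hleg z hz)).2

end Summit.SmoothPoincare4.SmoothPoincare4.Theorems.ContractibleTwistedDoubleStandard.PropertyRMazurHalves
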